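import Literature.NumberTheory.Transcendental.KZProductIdeal
import Literature.NumberTheory.Transcendental.KZGroundingRelations
import Literature.NumberTheory.Transcendental.KZConstantTerm
import Literature.NumberTheory.Transcendental.KZCubicalCalculus

/-!
# `CubeKernelStep` (stmt-KontsevichZagierPeriods-17854), line `Sketch`, stub `stub_fibreNullFiniteRankIndep`

RUNG K1 in the FINITE-RANK (Künneth) sector of the crux `CubeKernelStep` (route UnfoldedStokes):
under the lower layers `K(≤d)` (every continuous closed-cube representation of dimension `≤ d`
with value `0` is a Kontsevich–Zagier relation), a closed `(d+1)`-cube representation `t` whose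
integrand is, on the cube, a finite sum `∑ᵢ bᵢ(z 0) · aᵢ(tail z)` of separated products with
`bᵢ`, `aᵢ` continuous and `ℚ`-semialgebraic on the closed cubes and the restrictions `bᵢ|[0,1]`
linearly independent over `ℝ`, and all of whose slice values over the parameter `z 0 = s ∈ [0,1]`
vanish, is a relation.

Proof. (1) For `s ∈ [0,1]` the slice `{x | vecCons s x ∈ [0,1]^{d+1}}` is the `d`-cube and on it
`t (vecCons s x) = ∑ᵢ bᵢ(s) aᵢ(x)`, so `sliceValue t s = ∑ᵢ bᵢ(s) · βᵢ` with `βᵢ = ∫_{[0,1]^d} aᵢ`.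
(2) Fibre-nullity gives `∑ᵢ βᵢ • bᵢ|[0,1] = 0`, hence `β = 0` by linear independence.
(3) The closed `d`-cube representations `Aᵢ = [[0,1]^d, aᵢ]` have value `βᵢ = 0`, so `K(≤d)` at
`M = d` makes them relations; with `Bᵢ = [[0,1], y ↦ bᵢ(y 0)]` the products `[Bᵢ] · [Aᵢ] =
[Bᵢ.prod Aᵢ]` are relations (`relations` is a left ideal, `KZ.mul_mem_relations_left_holds`;
`KZ.of_mul_of`). (4) Reindexing along `Fin (1 + d) ≃ Fin (d + 1)` is a move
(`KZ.of_sub_of_reindex_mem_relations`); the reindexed product lives on the closed `(d+1)`-cube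
with integrand `bᵢ(w 0) · aᵢ(tail w)`. (5) Iterated integrand additivity
(`KZ.of_sub_sum_integrand_mem_relations`) gives `[t] − ∑ᵢ [Pᵢ] ∈ relations`, and each `[Pᵢ]` is a
relation. The hypothesis `1 ≤ d` is not used.

References: M. Kontsevich, D. Zagier, *Periods* (2001), §1.2 (rules), §4.1 (p. 31, products by
Fubini).
-/

noncomputable section

set_option linter.dupNamespace false

namespace Summit.KontsevichZagierPeriods.KontsevichZagierPeriods.Cruxes.CubeKernelStep.Layers

open MeasureTheory Set
open scoped BigOperators
open Literature.NumberTheory.Transcendental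
open Literature.NumberTheory.Transcendental.KZ

/-- The coordinate cast `Fin (1 + d) ≃ Fin (d + 1)` sends the left block `Fin 1` to `0`.
[folklore] -/
theorem finRank_finCongr_castAdd (d : ℕ) (i : Fin 1) :
    finCongr (Nat.add_comm 1 d) (Fin.castAdd d i) = 0 := by
  ext
  simp only [finCongr_apply, Fin.val_cast, Fin.val_castAdd, Fin.val_eq_zero i, Fin.val_zero]

/-- The coordinate cast `Fin (1 + d) ≃ Fin (d + 1)` sends the right block `Fin d` to the successors.
[folklore] -/
theorem finRank_finCongr_natAdd (d : ℕ) (j : Fin d) :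
    finCongr (Nat.add_comm 1 d) (Fin.natAdd 1 j) = j.succ := by
  ext
  simp only [finCongr_apply, Fin.val_cast, Fin.val_natAdd, Fin.val_succ, Nat.add_comm]

/-- `Fin.tail` of `Matrix.vecCons s x` is `x`. [folklore] -/
theorem finRank_tail_vecCons {d : ℕ} (s : ℝ) (x : Fin d → ℝ) :
    Fin.tail (Matrix.vecCons s x) = x :=
  Fin.tail_cons _ _

/-- The reindexed product `[0,1] × [0,1]^d ↝ [0,1]^{d+1}` lives on the closed `(d+1)`-cube.
[folklore] -/
theorem finRank_reindex_prod_domain {d : ℕ} (B : IntegralRep 1) (A : IntegralRep d)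
    (hB : B.domain = Set.Icc (0 : Fin 1 → ℝ) 1)
    (hA : A.domain = Set.pi Set.univ (fun _ : Fin d => Set.Icc (0:ℝ) 1)) :
    ((B.prod A).reindex (finCongr (Nat.add_comm 1 d))).domain =
      Set.pi Set.univ (fun _ : Fin (d + 1) => Set.Icc (0:ℝ) 1) := by
  ext w
  simp only [IntegralRep.reindex_domain, IntegralRep.prod_domain, mem_setOf_eq,
    IntegralRep.mem_prodDomain, hA, hB, finRank_finCongr_castAdd, finRank_finCongr_natAdd,
    mem_univ_pi, mem_Icc, Pi.le_def, Pi.zero_apply, Pi.one_apply, forall_const]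
  rw [Fin.forall_fin_succ]

/-- The integrand of the reindexed product is the separated product `b(w 0) · a(tail w)`.
[cite: KontsevichZagier2001, §4.1] -/
theorem finRank_reindex_prod_integrand {d : ℕ} (B : IntegralRep 1) (A : IntegralRep d)
    (w : Fin (d + 1) → ℝ) :
    ((B.prod A).reindex (finCongr (Nat.add_comm 1 d))).integrand w =
      B.integrand (fun _ => w 0) * A.integrand (Fin.tail w) := by
  simp only [IntegralRep.reindex_integrand, IntegralRep.prod_integrand_eq,
    IntegralRep.prodFun_apply, finRank_finCongr_castAdd, finRank_finCongr_natAdd]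
  rfl

/-- If `[A]` is a relation then so is the reindexed product `[B.prod A]` moved to dimension
`d + 1`: left ideal property, `of_mul_of`, and the reindexing move.
[cite: KontsevichZagier2001, §1.2] -/
theorem finRank_reindex_prod_mem_relations {d : ℕ} (B : IntegralRep 1) (A : IntegralRep d)
    (hA : of A ∈ relations) :
    of ((B.prod A).reindex (finCongr (Nat.add_comm 1 d))) ∈ relations := by
  have h1 : of (B.prod A) ∈ relations := by
    rw [← of_mul_of]
    exact mul_mem_relations_left_holds _ _ hA
  have h2 := of_sub_of_reindex_mem_relations (B.prod A) (finCongr (Nat.add_comm 1 d))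
  have h := relations.sub_mem h1 h2
  rwa [sub_sub_cancel] at h

/-- For `s ∈ [0,1]`, the slice of the closed `(d+1)`-cube over `z 0 = s` is the closed `d`-cube.
[folklore] -/
theorem finRank_slice_eq_cube {d : ℕ} (t : IntegralRep (d + 1))
    (htd : t.domain = Set.pi Set.univ (fun _ : Fin (d + 1) => Set.Icc (0:ℝ) 1))
    {s : ℝ} (hs : s ∈ Set.Icc (0:ℝ) 1) :
    {x : Fin d → ℝ | Matrix.vecCons s x ∈ t.domain} =
      Set.pi Set.univ (fun _ : Fin d => Set.Icc (0:ℝ) 1) := by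
  ext x
  simp only [mem_setOf_eq, htd, mem_univ_pi, Fin.forall_fin_succ, Matrix.cons_val_zero,
    Matrix.cons_val_succ]
  exact ⟨fun h => h.2, fun h => ⟨hs, h⟩⟩

/-- The slice value of a separated finite-rank family over `z 0 = s ∈ [0,1]` is
`∑ᵢ bᵢ(s) · ∫_{[0,1]^d} aᵢ`. [cite: KontsevichZagier2001, §1.2] -/
theorem finRank_sliceValue_eq {d k : ℕ} (b : Fin k → ℝ → ℝ) (a : Fin k → (Fin d → ℝ) → ℝ)
    (ha : ∀ i, IntegrableOn (a i) (Set.pi Set.univ (fun _ : Fin d => Set.Icc (0:ℝ) 1)))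
    (t : IntegralRep (d + 1))
    (htd : t.domain = Set.pi Set.univ (fun _ : Fin (d + 1) => Set.Icc (0:ℝ) 1))
    (heq : Set.EqOn t.integrand (fun z => ∑ i, b i (z 0) * a i (Fin.tail z)) t.domain)
    {s : ℝ} (hs : s ∈ Set.Icc (0:ℝ) 1) :
    sliceValue t s =
      ∑ i, b i s * ∫ x in Set.pi Set.univ (fun _ : Fin d => Set.Icc (0:ℝ) 1), a i x := by
  rw [sliceValue_def, finRank_slice_eq_cube t htd hs]
  have hmeas : MeasurableSet (Set.pi Set.univ (fun _ : Fin d => Set.Icc (0:ℝ) 1)) :=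
    MeasurableSet.univ_pi fun _ => measurableSet_Icc
  have hcongr : Set.EqOn (fun x : Fin d → ℝ => t.integrand (Matrix.vecCons s x))
      (fun x => ∑ i, b i s * a i x) (Set.pi Set.univ (fun _ : Fin d => Set.Icc (0:ℝ) 1)) := by
    intro x hx
    have hmem : Matrix.vecCons s x ∈ t.domain := by
      rw [← mem_setOf_eq (p := fun x : Fin d → ℝ => Matrix.vecCons s x ∈ t.domain),
        finRank_slice_eq_cube t htd hs]
      exact hx
    show t.integrand (Matrix.vecCons s x) = ∑ i, b i s * a i x
    rw [heq hmem]
    simp only [Matrix.cons_val_zero, finRank_tail_vecCons]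
  rw [setIntegral_congr_fun hmeas hcongr,
    integral_finsetSum Finset.univ fun i _ => (ha i).const_mul (b i s)]
  simp only [integral_const_mul]

/-- RUNG (K1 in the finite-rank sector) of the crux `CubeKernelStep`: **a fibre-null finite-rank
family with linearly independent parameter functions is a relation.** Under `K(≤d)`, a
representation on the closed `(d+1)`-cube whose integrand is `∑_{i<k} bᵢ(z 0) · aᵢ(tail z)` with
`bᵢ`, `aᵢ` continuous and `ℚ`-semialgebraic on the closed cubes and the restrictions `bᵢ|[0,1]`
linearly independent over `ℝ`, and which is fibre-null over `z 0`, is a relation: the slice value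
at `s` is `∑ᵢ bᵢ(s) ∫aᵢ`, independence forces every `∫aᵢ = 0`, `K(≤d)` kills `[[0,1]^d, aᵢ]`,
`relations` is a left ideal for the Fubini product (`KZ.of_mul_of`,
`KZ.mul_mem_relations_left_holds`), one coordinate reindexing `Fin (1 + d) ≃ Fin (d + 1)` is a
move, and iterated integrand additivity concludes. [cite: KontsevichZagier2001, §4.1] -/
theorem stub_fibreNullFiniteRankIndep :
    ∀ d : ℕ, 1 ≤ d →
      (∀ (M : ℕ), M ≤ d → ∀ (a : IntegralRep M),
        a.domain = Set.pi Set.univ (fun _ : Fin M => Set.Icc (0:ℝ) 1) →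
        ContinuousOn a.integrand a.domain → a.value = 0 → of a ∈ relations) →
      ∀ (k : ℕ) (b : Fin k → ℝ → ℝ) (a : Fin k → (Fin d → ℝ) → ℝ),
        (∀ i, IsSemialgebraicFunOn ℚ (Set.Icc (0 : Fin 1 → ℝ) 1) (fun y => b i (y 0))) →
        (∀ i, IsSemialgebraicFunOn ℚ (Set.pi Set.univ (fun _ : Fin d => Set.Icc (0:ℝ) 1)) (a i)) →
        (∀ i, ContinuousOn (b i) (Set.Icc (0:ℝ) 1)) →
        (∀ i, ContinuousOn (a i) (Set.pi Set.univ (fun _ : Fin d => Set.Icc (0:ℝ) 1))) →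
        LinearIndependent ℝ (fun i => (Set.Icc (0:ℝ) 1).restrict (b i)) →
        ∀ (t : IntegralRep (d + 1)),
          t.domain = Set.pi Set.univ (fun _ : Fin (d + 1) => Set.Icc (0:ℝ) 1) →
          Set.EqOn t.integrand (fun z => ∑ i, b i (z 0) * a i (Fin.tail z)) t.domain →
          (∀ s ∈ Set.Icc (0:ℝ) 1, sliceValue t s = 0) → of t ∈ relations := by
  intro d _ hK k b a hb_sa ha_sa hb ha hli t htd heq hslice
  -- integrability of the `aᵢ` on the compact cube
  have ha_int : ∀ i, IntegrableOn (a i) (Set.pi Set.univ (fun _ : Fin d => Set.Icc (0:ℝ) 1)) :=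
    fun i => (ha i).integrableOn_compact (isCompact_univ_pi fun _ => isCompact_Icc)
  -- (2) the cube integrals `βᵢ = ∫ aᵢ` vanish, by linear independence of the `bᵢ|[0,1]`
  have hβ : ∀ i, (∫ x in Set.pi Set.univ (fun _ : Fin d => Set.Icc (0:ℝ) 1), a i x) = 0 := by
    refine Fintype.linearIndependent_iff.mp hli
      (fun i => ∫ x in Set.pi Set.univ (fun _ : Fin d => Set.Icc (0:ℝ) 1), a i x) ?_
    funext y
    obtain ⟨s, hs⟩ := y
    have h0 := hslice s hs
    rw [finRank_sliceValue_eq b a ha_int t htd heq hs] at h0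
    simp only [Finset.sum_apply, Pi.smul_apply, Set.restrict_apply, smul_eq_mul, Pi.zero_apply]
    exact (Finset.sum_congr rfl fun i _ => mul_comm _ _).trans h0
  -- (3) the closed `d`-cube representations `Aᵢ = [[0,1]^d, aᵢ]` are relations by `K(≤d)`
  have hAex : ∀ i, ∃ A : IntegralRep d,
      A.domain = Set.pi Set.univ (fun _ : Fin d => Set.Icc (0:ℝ) 1) ∧ A.integrand = a i :=
    fun i => ⟨⟨Set.pi Set.univ (fun _ : Fin d => Set.Icc (0:ℝ) 1), a i,
      by rw [← KZ.cube_eq_pi]; exact KZ.isSemialgebraic_cube, ha_sa i, ha_int i⟩, rfl, rfl⟩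
  choose A hAd hAi using hAex
  have hA_rel : ∀ i, of (A i) ∈ relations := by
    intro i
    refine hK d le_rfl (A i) (hAd i) ?_ ?_
    · rw [hAd, hAi]
      exact ha i
    · rw [IntegralRep.value, hAd, hAi]
      exact hβ i
  -- the closed-interval representations `Bᵢ = [[0,1], y ↦ bᵢ (y 0)]`
  have hBex : ∀ i, ∃ B : IntegralRep 1,
      B.domain = Set.Icc (0 : Fin 1 → ℝ) 1 ∧ B.integrand = fun y => b i (y 0) :=
    fun i => ⟨⟨Set.Icc (0 : Fin 1 → ℝ) 1, fun y => b i (y 0),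
      by rw [← KZ.cube_eq_Icc]; exact KZ.isSemialgebraic_cube, hb_sa i,
      ContinuousOn.integrableOn_compact isCompact_Icc
        ((hb i).comp (continuous_apply 0).continuousOn fun y hy => ⟨hy.1 0, hy.2 0⟩)⟩,
      rfl, rfl⟩
  choose B hBd hBi using hBex
  -- (4)/(5) the reindexed products `Pᵢ` cover `t` by iterated integrand additivity
  have hsum := of_sub_sum_integrand_mem_relations Finset.univ
    (fun i => ((B i).prod (A i)).reindex (finCongr (Nat.add_comm 1 d))) t
    (fun i _ => by rw [finRank_reindex_prod_domain (B i) (A i) (hBd i) (hAd i), htd])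
    (fun z hz => by
      rw [heq hz]
      simp only [finRank_reindex_prod_integrand, hBi, hAi])
  have hP : ∑ i, of (((B i).prod (A i)).reindex (finCongr (Nat.add_comm 1 d))) ∈ relations :=
    sum_mem fun i _ => finRank_reindex_prod_mem_relations (B i) (A i) (hA_rel i)
  have h := relations.add_mem hsum hP
  rwa [sub_add_cancel] at h

end Summit.KontsevichZagierPeriods.KontsevichZagierPeriods.Cruxes.CubeKernelStep.Layers
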